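import Summits.KontsevichZagierPeriods.KontsevichZagierPeriods.Theorems.LiouvilleUnfoldingLogKernelConjectureCensus
import Summits.KontsevichZagierPeriods.KontsevichZagierPeriods.Theorems.LiouvilleUnfoldingLogKernelConjectureCensusRing

/-!
# Skeleton for the piece `stub_spectatorFibration` (SF₁) of crux `LiouvilleUnfolding.LogKernelConjecture`
# (stmt-KontsevichZagierPeriods-2837) — "a plan for the bare side"

Planner seat `planner-skel-stmt-KontsevichZagierPeriods-2837-stub_spectatorFi-0`, 2026-08-17
(mode `skeleton-register`). The crux (= the summit by name, `SpectatorLocalisation.logKernelConjecture_iff_summit`)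
is split by the tree theorem
`LogKernelConjectureCensus.logKernelConjecture_iff_darkTorsion_and_spectatorFibration` into the two
registered pieces of line `spectator-localisation` (reshape 3, skeleton 437b6b9d):

* `stub_darkTorsion` (DT₁, arithmetic side) — planned by the sibling registrar seat
  (`Lines/stub_darkTorsion.lean`, sha efbcbca1: nilradical cut `DT₁ ↔ N₁ ∧ R₁`); its two stubs
  `stub_spectatorNilKernel`, `stub_spectatorReduced` are repeated below VERBATIM, because the crux item
  holds ONE skeleton record and registering either piece alone expires the other side's stubs (as
  happened at 04:04Z and 04:25Z); this file is therefore the TWO-SIDED skeleton of the crux;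
* `stub_spectatorFibration` (SF₁, structural side) — the OPEN piece without a skeleton. THIS FILE is
  its skeleton: three named stubs and the sorry-free composition `spectatorFibration₁_of_stubs`, whose
  statement is the registered signature of `stub_spectatorFibration` verbatim; `LogKernelConjecture_of`
  then concludes the crux BY NAME from the five stubs (sorries only in `stub_*`).

## The piece

  SF₁ : ∀ (s : IntegralRep 1) c, s.value ≠ 0 → [s]·c ∈ relations →
          ∃ c', c − c' ∈ relations ∧ [s]·c' ∈ fibredRelations,

equivalently (landed engine `SpectatorLocalisation.stub_split_fibredSpectatorCancellation`, p84766,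
and `stub_split_spectatorFibration_iff`, p87631) plain cancellation of good one-dimensional
spectators SC₁ : `[s]·c ∈ relations → c ∈ relations`. Its content is CERTIFICATE SURGERY: a
certificate of `[s]·c` by the four moves may use the two kinds of move instances that are NOT fibred
over the spectator coordinate `z 0` (`KZFibredRelations.lean`): (α) changes of variables `Φ` with
`Φ z 0 ≠ z 0`, (β) Newton–Leibniz moves to a base of dimension `0` (constants). The decomposition
below removes them in two provable steps and isolates the residue as ONE new kind of move.

## The three stubs (informal; sizes are guesses)

1. `stub_positiveCarrier` — CONSTANTS ARE NEVER NEEDED. If `[s]·c ∈ relations` then `[s]·c` already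
   lies in the subgroup generated by domain/integrand additivity, ALL changes of variables and the
   Newton–Leibniz moves over bases of dimension `≥ 1` (`KZ.fibredNewtonLeibnizRel`). Why true: the
   "constant-lifting" endomorphism `L` of `FormalRep` (`[pt, a] ↦ [[0,1], a]`, identity in dimension
   `≥ 1`) fixes `[s]·c` and maps every move instance into that subgroup — a Newton–Leibniz move
   `[[α,β], f] − [pt, F β − F α]` becomes the 3-move chain `[[α,β], f] ∼ [[α,β]×[0,1], f(t)]`
   (fibred NL, primitive `y·f t`) `∼ [[0,1]×[α,β], f(y)]` (coordinate swap) `∼ [[0,1], F β − F α]`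
   (fibred NL, primitive `F`). No value hypothesis needed. Size M (four generator cases, one chain).
2. `stub_reindexCarrier` — EVERY CHANGE OF VARIABLES IS FIBRED UP TO COORDINATE RELABELLING:
   `changeOfVariablesRel ⊆ closure (fibredGenerators ∪ ReindexMoves)`, `ReindexMoves` = the instances
   `[r] − [r.reindex e]`, `e` a permutation of the coordinates (`KZ.IntegralRep.reindex`,
   `KZ.of_sub_of_reindex_mem_relations`). Why true: on each open cell of a cylindrical decomposition
   adapted to `Φ` (off a null set, where `det DΦ ≠ 0` and some `∂Φ₀/∂zᵢ` has constant sign along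
   `zᵢ`-fibres), `Φ = C ∘ A₀ ∘ S₀ᵢ` with `S₀ᵢ` the transposition of coordinates `0, i`, `A₀` changing
   only coordinate `0` and `C` fixing coordinate `0` (fibred); and `A₀ = S₀ⱼ ∘ Aⱼ ∘ S₀ⱼ` with `Aⱼ`
   fibred (`j ≥ 1`; one-dimensional instances are first lifted to dimension 2 by a fibred
   Newton–Leibniz move). Pure real semialgebraic geometry (BCR §2.3, §9.3); no periods. Size L/XL.
3. `stub_reindexCancellation` — THE CORE: cancellation of good one-dimensional spectators for
   certificates built from FIBRED moves and COORDINATE RELABELLINGS: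
   `s.value ≠ 0 → [s]·c ∈ closure (fibredGenerators ∪ ReindexMoves) → c ∈ relations`.
   Sandwiched between the landed engine (fibred certificates cancel, p84766) and SC₁ ⟸ summit
   (`reindexCancellation_of_cancellation`, `reindexCancellation_of_summit` below, sorry-free); the single new
   move to absorb is the swap of the spectator coordinate with a factor coordinate — the recorded
   obstruction "Jacobian-twisted Φ mixing spectator and factor coordinates" in its smallest typed form.
   OPEN (expected hard: SF₁ ≥ `KZ.PiCancellation`, stmt-0540). `s.value ≠ 0` is load-bearing
   (honours `SpectatorEngineSharp.spectatorCancellation₁_false_without_value`: the odd spectator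
   `[[-1,1], t]` kills `[pt,1]`, and `[[-1,1],t]·[pt,1] = [[-1,1],t]` is a fibred-plus-reindex
   certificate by stubs 1–2).

Composition: `[s]·c ∈ relations` ⟹ (1) `∈ closure (positive generators)` ⟹ (2, `closure_le`)
`∈ closure (fibredGenerators ∪ ReindexMoves)` ⟹ (3) `c ∈ relations` ⟹ SF₁ with `c' := 0`.

Disproof.lean (cdisprove §1–§18) used: §5 — `relations ≤ R` is the crux's only load-bearing clause;
irrelevant below the split (the pieces live at `R := relations`). drefute g1/g2: 0 stub-false; the
value guard (above). Negative/ lemmas checked: `not_fibredSpectatorCancellation₁_fibred` (no stub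
concludes `c ∈ fibredRelations`), `fibredRelations_lt_relations` (stub 1's target subgroup is
strictly larger than `fibredRelations`: it contains all changes of variables).

Probes (planner folder `bc/`, `lean check`): for each of the three SF-stubs, `stub → SF₁` and
`stub → KontsevichZagierPeriods` by `first | exact? | simpa | aesop` FAIL (see NOTES.md of the seat
for rc and goals); no stub is the piece or the summit in disguise.
-/

noncomputable section

open Literature.NumberTheory.Transcendental

namespace Summit.KontsevichZagierPeriods.LiouvilleUnfolding.SpectatorLocalisation.SpectatorFibration

/-! ## Vocabulary (local abbreviations; the stubs inline them so that their signatures are tree-closed) -/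

/-- The POSITIVE move generators: domain and integrand additivity, all changes of variables, and the
Newton–Leibniz moves over a base of dimension `≥ 1` (no move to or from a constant). -/
def positiveGenerators : Set KZ.FormalRep :=
  KZ.domainAddRel ∪ KZ.integrandAddRel ∪ KZ.changeOfVariablesRel ∪ KZ.fibredNewtonLeibnizRel

/-- The COORDINATE RELABELLING moves `[r] − [r.reindex e]`, `e` a permutation of `Fin n`. -/
def reindexMoves : Set KZ.FormalRep :=
  {c | ∃ (n : ℕ) (e : Equiv.Perm (Fin n)) (r : KZ.IntegralRep n), c = KZ.of r - KZ.of (r.reindex e)}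

/-- Fibred moves together with coordinate relabellings. -/
def fibredReindexGenerators : Set KZ.FormalRep := KZ.fibredGenerators ∪ reindexMoves

/-! ## The three stubs of the piece SF₁ -/

/-- **Stub 1 — constants are never needed.** A four-move certificate of a spectator product
`[s]·c` can be replaced by one using only domain/integrand additivity, changes of variables and
Newton–Leibniz moves over bases of dimension `≥ 1` (constant lifting `[pt,a] ↦ [[0,1],a]`). -/
theorem stub_positiveCarrier :
    ∀ (s : Literature.NumberTheory.Transcendental.KZ.IntegralRep 1) (c : Literature.NumberTheory.Transcendental.KZ.FormalRep), Literature.NumberTheory.Transcendental.KZ.of s * c ∈ Literature.NumberTheory.Transcendental.KZ.relations → Literature.NumberTheory.Transcendental.KZ.of s * c ∈ AddSubgroup.closure (Literature.NumberTheory.Transcendental.KZ.domainAddRel ∪ Literature.NumberTheory.Transcendental.KZ.integrandAddRel ∪ Literature.NumberTheory.Transcendental.KZ.changeOfVariablesRel ∪ Literature.NumberTheory.Transcendental.KZ.fibredNewtonLeibnizRel) := by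
  sorry

/-- **Stub 2 — every change of variables is fibred up to coordinate relabelling.** Each instance of
rule (2) lies in the subgroup generated by the fibred move generators and the relabelling moves
`[r] − [r.reindex e]` (cellwise triangular factorisation `Φ = C ∘ A₀ ∘ S₀ᵢ`). -/
theorem stub_reindexCarrier :
    Literature.NumberTheory.Transcendental.KZ.changeOfVariablesRel ⊆ (AddSubgroup.closure (Literature.NumberTheory.Transcendental.KZ.fibredGenerators ∪ {c : Literature.NumberTheory.Transcendental.KZ.FormalRep | ∃ (n : ℕ) (e : Equiv.Perm (Fin n)) (r : Literature.NumberTheory.Transcendental.KZ.IntegralRep n), c = Literature.NumberTheory.Transcendental.KZ.of r - Literature.NumberTheory.Transcendental.KZ.of (r.reindex e)}) : Set Literature.NumberTheory.Transcendental.KZ.FormalRep) := by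
  sorry

/-- **Stub 3 — the core: good one-dimensional spectators cancel across fibred moves and coordinate
relabellings.** If `s.value ≠ 0` and `[s]·c` has a certificate by fibred moves and relabellings,
then `c` is a relation. (Landed for fibred certificates alone: `stub_split_fibredSpectatorCancellation`.) -/
theorem stub_reindexCancellation :
    ∀ (s : Literature.NumberTheory.Transcendental.KZ.IntegralRep 1) (c : Literature.NumberTheory.Transcendental.KZ.FormalRep), s.value ≠ 0 → Literature.NumberTheory.Transcendental.KZ.of s * c ∈ AddSubgroup.closure (Literature.NumberTheory.Transcendental.KZ.fibredGenerators ∪ {c : Literature.NumberTheory.Transcendental.KZ.FormalRep | ∃ (n : ℕ) (e : Equiv.Perm (Fin n)) (r : Literature.NumberTheory.Transcendental.KZ.IntegralRep n), c = Literature.NumberTheory.Transcendental.KZ.of r - Literature.NumberTheory.Transcendental.KZ.of (r.reindex e)}) → c ∈ Literature.NumberTheory.Transcendental.KZ.relations := by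
  sorry

/-! ## The other piece `stub_darkTorsion` (DT₁): its two registered stubs, VERBATIM from the sibling
skeleton `Lines/stub_darkTorsion.lean` (seat planner-skel-stmt-KontsevichZagierPeriods-2837-stub_darkTorsion-0,
sha efbcbca1; nilradical cut at the spectator monoid — see `Lines/stub_darkTorsion.md` for their card).
They are repeated here so that ONE registered skeleton of the crux item carries the plans of BOTH sides
(the item holds a single skeleton record; registering either piece alone expires the other's stubs). -/

/-- **DT-stub 1 — `SpectatorNilKernel` (N₁, transcendence half; verbatim from `Lines/stub_darkTorsion.lean`).**
Every formal period of value `0` is nilpotent after inverting the good one-dimensional spectators.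
Implied by item stmt-0541 (`spectatorNilKernel_of_item0541` there). OPEN. -/
theorem stub_spectatorNilKernel :
    ∀ x : Literature.NumberTheory.Transcendental.KZ.FormalPeriodRing,
      Literature.NumberTheory.Transcendental.KZ.evalP x = 0 →
        ∃ (l : List (Literature.NumberTheory.Transcendental.KZ.IntegralRep 1)) (k : ℕ),
          (∀ s ∈ l, s.value ≠ 0) ∧
            (l.map fun s => Literature.NumberTheory.Transcendental.KZ.toFormalPeriod
              (Literature.NumberTheory.Transcendental.KZ.of s)).prod * x ^ (k + 1) = 0 := by
  sorry

/-- **DT-stub 2 — `SpectatorReduced` (R₁, transcendence-free half; verbatim from `Lines/stub_darkTorsion.lean`).**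
An `S₁`-locally nilpotent class is `S₁`-torsion. Implied by `IsReduced P` (item stmt-3929) and by
`IsDomain P` (`spectatorReduced_of_isReduced / _of_isDomain` there). OPEN. -/
theorem stub_spectatorReduced :
    ∀ x : Literature.NumberTheory.Transcendental.KZ.FormalPeriodRing,
      (∃ (l : List (Literature.NumberTheory.Transcendental.KZ.IntegralRep 1)) (k : ℕ),
          (∀ s ∈ l, s.value ≠ 0) ∧
            (l.map fun s => Literature.NumberTheory.Transcendental.KZ.toFormalPeriod
              (Literature.NumberTheory.Transcendental.KZ.of s)).prod * x ^ (k + 1) = 0) →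
        ∃ l : List (Literature.NumberTheory.Transcendental.KZ.IntegralRep 1),
          (∀ s ∈ l, s.value ≠ 0) ∧
            (l.map fun s => Literature.NumberTheory.Transcendental.KZ.toFormalPeriod
              (Literature.NumberTheory.Transcendental.KZ.of s)).prod * x = 0 := by
  sorry

/-! ## Sorry-free glue -/

/-- The local vocabulary agrees with the inlined sets (definitional). -/
theorem fibredReindexGenerators_def :
    fibredReindexGenerators = KZ.fibredGenerators ∪ {c : KZ.FormalRep | ∃ (n : ℕ) (e : Equiv.Perm (Fin n)) (r : KZ.IntegralRep n), c = KZ.of r - KZ.of (r.reindex e)} :=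
  rfl

/-- The positive relations are generated by fibred moves and relabellings (stub 2 + bookkeeping). -/
theorem closure_positiveGenerators_le :
    AddSubgroup.closure positiveGenerators ≤ AddSubgroup.closure fibredReindexGenerators := by
  apply (AddSubgroup.closure_le _).mpr
  rintro x (((hx | hx) | hx) | hx)
  · exact AddSubgroup.subset_closure (Or.inl (KZ.domainAddRel_subset_fibredGenerators hx))
  · exact AddSubgroup.subset_closure (Or.inl (KZ.integrandAddRel_subset_fibredGenerators hx))
  · exact stub_reindexCarrier hx
  · exact AddSubgroup.subset_closure (Or.inl (KZ.fibredNewtonLeibnizRel_subset_fibredGenerators hx))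

/-- **Cancellation of good one-dimensional spectators (SC₁) from the three stubs.** -/
theorem spectatorCancellation₁_of_stubs (s : KZ.IntegralRep 1) (c : KZ.FormalRep) (hs : s.value ≠ 0)
    (h : KZ.of s * c ∈ KZ.relations) : c ∈ KZ.relations :=
  stub_reindexCancellation s c hs (closure_positiveGenerators_le (stub_positiveCarrier s c h))

/-- **The piece BY ITS REGISTERED SIGNATURE**: `stub_spectatorFibration` (SF₁, skeleton 437b6b9d,
inlined verbatim) from the three stubs, with the fibred witness `c' := 0`. -/
theorem spectatorFibration₁_of_stubs : ∀ (s : Literature.NumberTheory.Transcendental.KZ.IntegralRep 1) (c : Literature.NumberTheory.Transcendental.KZ.FormalRep), s.value ≠ 0 → Literature.NumberTheory.Transcendental.KZ.of s * c ∈ Literature.NumberTheory.Transcendental.KZ.relations → ∃ c' : Literature.NumberTheory.Transcendental.KZ.FormalRep, c - c' ∈ Literature.NumberTheory.Transcendental.KZ.relations ∧ Literature.NumberTheory.Transcendental.KZ.of s * c' ∈ Literature.NumberTheory.Transcendental.KZ.fibredRelations := by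
  intro s c hs h
  exact ⟨0, by simpa using spectatorCancellation₁_of_stubs s c hs h, by simp⟩

/-- **The arithmetic piece `stub_darkTorsion` (DT₁, registered signature verbatim) from the two DT-stubs**
(ring form `LogKernelConjectureCensus.darkTorsion₁_iff_listProd`: N₁ makes a class of value `0`
`S₁`-locally nilpotent, R₁ makes it `S₁`-torsion; this is `StubDarkTorsion.darkTorsion_iff_stubs`, `←`). -/
theorem darkTorsion₁_of_stubs :
    ∀ c : Literature.NumberTheory.Transcendental.KZ.FormalRep, Literature.NumberTheory.Transcendental.KZ.eval c = 0 → ∃ l : List (Literature.NumberTheory.Transcendental.KZ.IntegralRep 1), (∀ s ∈ l, s.value ≠ 0) ∧ List.foldr (fun s x => Literature.NumberTheory.Transcendental.KZ.of s * x) c l ∈ Literature.NumberTheory.Transcendental.KZ.relations := by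
  rw [LogKernelConjectureCensus.darkTorsion₁_iff_listProd]
  intro x hx
  exact stub_spectatorReduced x (stub_spectatorNilKernel x hx)

/-! ## The crux BY NAME -/

/-- **The crux `LogKernelConjecture` from the five stubs (two DT-stubs, three SF-stubs)**, through the tree theorem
`logKernelConjecture_iff_darkTorsion_and_spectatorFibration` (the crux is EXACTLY DT₁ ∧ SF₁). -/
theorem LogKernelConjecture_of :
    Summit.KontsevichZagierPeriods.KontsevichZagierPeriods.Theses.LiouvilleUnfolding.LogKernelConjecture :=
  LogKernelConjectureCensus.logKernelConjecture_iff_darkTorsion_and_spectatorFibration.mpr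
    ⟨darkTorsion₁_of_stubs, spectatorFibration₁_of_stubs⟩

/-! ## Position of the stubs (sorry-free, for refuters and workers) -/

/-- Relabelling moves are relations (each is a change-of-variables move,
`KZ.of_sub_of_reindex_mem_relations`). -/
theorem reindexMoves_subset_relations : reindexMoves ⊆ (KZ.relations : Set KZ.FormalRep) := by
  rintro c ⟨n, e, r, rfl⟩
  exact KZ.of_sub_of_reindex_mem_relations r e

/-- Fibred-plus-relabelling certificates are certificates. -/
theorem closure_fibredReindexGenerators_le_relations :
    AddSubgroup.closure fibredReindexGenerators ≤ KZ.relations := by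
  apply (AddSubgroup.closure_le _).mpr
  rintro x (hx | hx)
  · exact KZ.fibredGenerators_subset_relations hx
  · exact reindexMoves_subset_relations hx

/-- Fibred certificates are fibred-plus-relabelling certificates: stub 3 EXTENDS the landed engine
`stub_split_fibredSpectatorCancellation` by exactly one kind of move. -/
theorem fibredRelations_le_closure_fibredReindexGenerators :
    KZ.fibredRelations ≤ AddSubgroup.closure fibredReindexGenerators :=
  AddSubgroup.closure_mono Set.subset_union_left

/-- Stub 3 is AT MOST cancellation of good one-dimensional spectators (SC₁ ⟺ SF₁). -/
theorem reindexCancellation_of_cancellation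
    (hC : ∀ (s : KZ.IntegralRep 1) (c : KZ.FormalRep), s.value ≠ 0 → KZ.of s * c ∈ KZ.relations →
      c ∈ KZ.relations)
    (s : KZ.IntegralRep 1) (c : KZ.FormalRep) (hs : s.value ≠ 0)
    (h : KZ.of s * c ∈ AddSubgroup.closure fibredReindexGenerators) : c ∈ KZ.relations :=
  hC s c hs (closure_fibredReindexGenerators_le_relations h)

/-- Stub 3 is implied by the summit (so it cannot be refuted short of refuting Conjecture 1):
`[s]·c ∈ relations ⇒ s.value · eval c = 0 ⇒ eval c = 0 ⇒ c ∈ relations`. -/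
theorem reindexCancellation_of_summit (hS : KontsevichZagierPeriods)
    (s : KZ.IntegralRep 1) (c : KZ.FormalRep) (hs : s.value ≠ 0)
    (h : KZ.of s * c ∈ AddSubgroup.closure fibredReindexGenerators) : c ∈ KZ.relations := by
  have hK : KZKernelConjecture := LogKernelConjectureNegative.summit_iff_kzKernelConjecture.mp hS
  have h0 : KZ.eval (KZ.of s * c) = 0 :=
    KZ.relations_le_ker_eval_holds (closure_fibredReindexGenerators_le_relations h)
  rw [KZ.eval_mul', KZ.eval_of] at h0
  exact hK c ((mul_eq_zero.mp h0).resolve_left hs)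

/-- **Special case of stub 3, sorry-free (BC5-style): EXACT spectators cancel across any certificate.**
If the four rules connect `s` to a non-zero constant `R` (e.g. `[[a,b],(b−a)⁻¹]`, `[[0,1],2t]`), then `⟦[s]⟧` is a
unit of the formal period ring (`LogKernelConjectureCensus.isUnit_toFormalPeriod_of_equivalent_dimZero`) and stub 3
holds at `s` — its content starts at non-exact spectators (`[[1,2],1/t]`, `[β(½,½)] ∼ [π]`). -/
theorem reindexCancellation_at_equivalent_dimZero (s : KZ.IntegralRep 1) (R : KZ.IntegralRep 0)
    (hsR : KZ.Equivalent s R) (hs : s.value ≠ 0) (c : KZ.FormalRep)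
    (h : KZ.of s * c ∈ AddSubgroup.closure fibredReindexGenerators) : c ∈ KZ.relations :=
  LogKernelConjectureCensus.cancellation_of_isUnit
    (LogKernelConjectureCensus.isUnit_toFormalPeriod_of_equivalent_dimZero hsR hs)
    (closure_fibredReindexGenerators_le_relations h)

/-- Stub 1's target subgroup sits between the fibred relations and all relations. -/
theorem fibredRelations_le_closure_positiveGenerators :
    KZ.fibredRelations ≤ AddSubgroup.closure positiveGenerators := by
  apply (AddSubgroup.closure_le _).mpr
  rintro x (((hx | hx) | hx) | hx)
  · exact AddSubgroup.subset_closure (Or.inl (Or.inl (Or.inl hx)))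
  · exact AddSubgroup.subset_closure (Or.inl (Or.inl (Or.inr hx)))
  · exact AddSubgroup.subset_closure
      (Or.inl (Or.inr (KZ.fibredChangeOfVariablesRel_subset_changeOfVariablesRel hx)))
  · exact AddSubgroup.subset_closure (Or.inr hx)

/-- … and is contained in `relations`. -/
theorem closure_positiveGenerators_le_relations :
    AddSubgroup.closure positiveGenerators ≤ KZ.relations := by
  apply (AddSubgroup.closure_le _).mpr
  rintro x (((hx | hx) | hx) | hx)
  · exact KZ.domainAddRel_subset_relations hx
  · exact KZ.integrandAddRel_subset_relations hx
  · exact KZ.changeOfVariablesRel_subset_relations hx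
  · exact KZ.newtonLeibnizRel_subset_relations (KZ.fibredNewtonLeibnizRel_subset_newtonLeibnizRel hx)

end Summit.KontsevichZagierPeriods.LiouvilleUnfolding.SpectatorLocalisation.SpectatorFibration

end
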